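import Literature.Combinatorics.Sahi2008.Functional
import Mathlib.Tactic.Linarith
import Mathlib.Tactic.Ring
import HarnessLib

/-!
# `NoHeavyLowerTail` (crux stmt-CriticalPhenomena-4575), P2 — chain triangle, part 2/4: the six-fold clone functional `E6` and its calculus

Memo SAHI-ROUTE.md §4.17 (seat `prim-masterthm-p2`, gen 5; `--supports stmt-CriticalPhenomena-4575`).  No `sorry`, no named facts, standard axioms.

THE THEOREM (file `…SahiChainTriangle`): for probability weights `wA, wB, wC` on three finite LINEAR orders `α, β, γ` and nonnegative coordinatewise
increasing `f : γ → α → ℝ`, `g : γ → β → ℝ`, `h : α → β → ℝ` (a "triangle": each function sees two of three independent chains), under the product weight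
on `α × β × γ`:  `2·E_3(f,g,h) ≥ P_A + P_B + P_C ≥ 0`, `P_C = Σ_{a,b} wA wB h·Cov_c(f(·,a),g(·,b))` etc.; in particular Sahi's `C_3` holds for this class
(Lieb–Sahi [LiebSahi2021, Thm 3.7] is the square — two chains; three chains are open in general).  PROOF: two independent clones per chain,
`8P_X = E[S_X]`, `8(ΣP − E_3) = E[Δ²fΔ²gΔ²h]`, and the POINTWISE inequality `S_A+S_B+S_C ≥ 2Δ²fΔ²gΔ²h` on chains.

This part: `ex_prod3` / `drop_*` (the product expectation as iterated sums), `swap_pairs`, and the functional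
`E6 Φ = Σ_{a,a'} wA wA' Σ_{b,b'} wB wB' Σ_{c,c'} wC wC' Φ` with linearity, clone symmetries (`E6_swap_*`), collapse of unused clones (`E6_of_abc`),
product rules (`E6_prod`, `E6_prod3`) and re-nestings (`E6_cba`, `E6_cab`).
-/

noncomputable section

open scoped Classical

namespace Summit.CriticalPhenomena.PercolationContinuityZ3.Theorems

namespace SahiChainTriangle

open Finset
open Literature.Combinatorics.Sahi2008

/-! ### The triangle: three chains `α, β, γ`, `f` on `γ × α`, `g` on `γ × β`, `h` on `α × β` -/

section Triangle

variable {α β γ : Type} [Fintype α] [Fintype β] [Fintype γ]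
  (wA : α → ℝ) (wB : β → ℝ) (wC : γ → ℝ) (f : γ → α → ℝ) (g : γ → β → ℝ) (h : α → β → ℝ)

/-! ### Bookkeeping: the product expectation as an iterated sum; dropping dummy sums -/

/-- Expectation under the product weight as an iterated sum (plumbing). [folklore] -/
theorem ex_prod3 (Φ : α × β × γ → ℝ) :
    ex (fun p : α × β × γ => wA p.1 * wB p.2.1 * wC p.2.2) Φ = ∑ a, ∑ b, ∑ c, wA a * wB b * wC c * Φ (a, b, c) := by
  rw [ex, Fintype.sum_prod_type]
  exact sum_congr rfl fun a _ => by rw [Fintype.sum_prod_type]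

/-- Dropping the dummy `a`-sum. [folklore] -/
theorem drop_a (hA' : ∑ a, wA a = 1) (φ : β → γ → ℝ) :
    (∑ a, ∑ b, ∑ c, wA a * wB b * wC c * φ b c) = ∑ b, ∑ c, wB b * wC c * φ b c := by
  have : (∑ a, ∑ b, ∑ c, wA a * wB b * wC c * φ b c) = ∑ a, wA a * ∑ b, ∑ c, wB b * wC c * φ b c := by
    refine sum_congr rfl fun a _ => ?_
    rw [mul_sum]; refine sum_congr rfl fun b _ => ?_
    rw [mul_sum]; exact sum_congr rfl fun c _ => by ring
  rw [this, ← sum_mul, hA', one_mul]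

/-- Dropping the dummy `b`-sum. [folklore] -/
theorem drop_b (hB : ∑ b, wB b = 1) (φ : α → γ → ℝ) :
    (∑ a, ∑ b, ∑ c, wA a * wB b * wC c * φ a c) = ∑ a, ∑ c, wA a * wC c * φ a c := by
  refine sum_congr rfl fun a _ => ?_
  have : (∑ b, ∑ c, wA a * wB b * wC c * φ a c) = ∑ b, wB b * ∑ c, wA a * wC c * φ a c := by
    refine sum_congr rfl fun b _ => ?_
    rw [mul_sum]; exact sum_congr rfl fun c _ => by ring
  rw [this, ← sum_mul, hB, one_mul]

/-- Dropping the dummy `c`-sum. [folklore] -/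
theorem drop_c (hC : ∑ c, wC c = 1) (φ : α → β → ℝ) :
    (∑ a, ∑ b, ∑ c, wA a * wB b * wC c * φ a b) = ∑ a, ∑ b, wA a * wB b * φ a b := by
  refine sum_congr rfl fun a _ => sum_congr rfl fun b _ => ?_
  have : (∑ c, wA a * wB b * wC c * φ a b) = (∑ c, wC c) * (wA a * wB b * φ a b) := by
    rw [sum_mul]; exact sum_congr rfl fun c _ => by ring
  rw [this, hC, one_mul]

end Triangle

section Swap

/-- Swapping two adjacent clone-pair blocks of a nested sum (plumbing). [folklore] -/
theorem swap_pairs {P Q : Type} [Fintype P] [Fintype Q] (wP : P → ℝ) (wQ : Q → ℝ) (Φ : P → P → Q → Q → ℝ) :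
    (∑ p, ∑ p', wP p * wP p' * ∑ q, ∑ q', wQ q * wQ q' * Φ p p' q q') =
      ∑ q, ∑ q', wQ q * wQ q' * ∑ p, ∑ p', wP p * wP p' * Φ p p' q q' := by
  have hL : (∑ p, ∑ p', wP p * wP p' * ∑ q, ∑ q', wQ q * wQ q' * Φ p p' q q') =
      ∑ pp : P × P, ∑ qq : Q × Q, wP pp.1 * wP pp.2 * (wQ qq.1 * wQ qq.2 * Φ pp.1 pp.2 qq.1 qq.2) := by
    rw [Fintype.sum_prod_type]
    refine sum_congr rfl fun p _ => sum_congr rfl fun p' _ => ?_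
    rw [mul_sum, Fintype.sum_prod_type]
    exact sum_congr rfl fun q _ => by rw [mul_sum]
  have hR : (∑ q, ∑ q', wQ q * wQ q' * ∑ p, ∑ p', wP p * wP p' * Φ p p' q q') =
      ∑ qq : Q × Q, ∑ pp : P × P, wP pp.1 * wP pp.2 * (wQ qq.1 * wQ qq.2 * Φ pp.1 pp.2 qq.1 qq.2) := by
    rw [Fintype.sum_prod_type]
    refine sum_congr rfl fun q _ => sum_congr rfl fun q' _ => ?_
    rw [mul_sum, Fintype.sum_prod_type]
    exact sum_congr rfl fun p _ => by rw [mul_sum]; exact sum_congr rfl fun p' _ => by ring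
  rw [hL, hR, sum_comm]

end Swap

/-! ### The six-fold clone functional `E6` and its calculus -/

section E6

variable {α β γ : Type} [Fintype α] [Fintype β] [Fintype γ] (wA : α → ℝ) (wB : β → ℝ) (wC : γ → ℝ)

/-- `E6 Φ = Σ_{a,a'} wA wA' Σ_{b,b'} wB wB' Σ_{c,c'} wC wC' Φ(a,a',b,b',c,c')`: expectation over two independent clones per chain. [this work] -/
def E6 (Φ : α → α → β → β → γ → γ → ℝ) : ℝ :=
  ∑ a, ∑ a', wA a * wA a' * ∑ b, ∑ b', wB b * wB b' * ∑ c, ∑ c', wC c * wC c' * Φ a a' b b' c c'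

/-- `E6` depends only on the values of the integrand. [folklore] -/
theorem E6_congr {Φ Ψ : α → α → β → β → γ → γ → ℝ} (h : ∀ a a' b b' c c', Φ a a' b b' c c' = Ψ a a' b b' c c') :
    E6 wA wB wC Φ = E6 wA wB wC Ψ := by
  unfold E6
  exact sum_congr rfl fun a _ => sum_congr rfl fun a' _ => congrArg _ (sum_congr rfl fun b _ => sum_congr rfl fun b' _ =>
    congrArg _ (sum_congr rfl fun c _ => sum_congr rfl fun c' _ => by rw [h]))

/-- `E6` is additive. [folklore] -/
theorem E6_add (Φ Ψ : α → α → β → β → γ → γ → ℝ) :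
    E6 wA wB wC (fun a a' b b' c c' => Φ a a' b b' c c' + Ψ a a' b b' c c') = E6 wA wB wC Φ + E6 wA wB wC Ψ := by
  unfold E6
  simp only [mul_add, sum_add_distrib]

/-- `E6` respects subtraction. [folklore] -/
theorem E6_sub (Φ Ψ : α → α → β → β → γ → γ → ℝ) :
    E6 wA wB wC (fun a a' b b' c c' => Φ a a' b b' c c' - Ψ a a' b b' c c') = E6 wA wB wC Φ - E6 wA wB wC Ψ := by
  unfold E6
  simp only [mul_sub, sum_sub_distrib]

/-- `E6` is homogeneous. [folklore] -/
theorem E6_smul (r : ℝ) (Φ : α → α → β → β → γ → γ → ℝ) :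
    E6 wA wB wC (fun a a' b b' c c' => r * Φ a a' b b' c c') = r * E6 wA wB wC Φ := by
  unfold E6
  simp only [mul_sum]
  exact sum_congr rfl fun _ _ => sum_congr rfl fun _ _ => sum_congr rfl fun _ _ => sum_congr rfl fun _ _ =>
    sum_congr rfl fun _ _ => sum_congr rfl fun _ _ => by ring

/-- Nonnegative integrand ⇒ `E6 ≥ 0` (for nonnegative weights). [folklore] -/
theorem E6_nonneg (hA0 : ∀ a, 0 ≤ wA a) (hB0 : ∀ b, 0 ≤ wB b) (hC0 : ∀ c, 0 ≤ wC c)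
    {Φ : α → α → β → β → γ → γ → ℝ} (h : ∀ a a' b b' c c', 0 ≤ Φ a a' b b' c c') : 0 ≤ E6 wA wB wC Φ := by
  unfold E6
  refine sum_nonneg fun a _ => sum_nonneg fun a' _ => mul_nonneg (mul_nonneg (hA0 a) (hA0 a')) ?_
  refine sum_nonneg fun b _ => sum_nonneg fun b' _ => mul_nonneg (mul_nonneg (hB0 b) (hB0 b')) ?_
  exact sum_nonneg fun c _ => sum_nonneg fun c' _ => mul_nonneg (mul_nonneg (hC0 c) (hC0 c')) (h a a' b b' c c')

/-- Clone symmetry in `c ↔ c'`. [folklore] -/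
theorem E6_swap_c (Φ : α → α → β → β → γ → γ → ℝ) :
    E6 wA wB wC (fun a a' b b' c c' => Φ a a' b b' c' c) = E6 wA wB wC Φ := by
  unfold E6
  refine sum_congr rfl fun a _ => sum_congr rfl fun a' _ => congrArg _ (sum_congr rfl fun b _ => sum_congr rfl fun b' _ => congrArg _ ?_)
  rw [sum_comm]
  exact sum_congr rfl fun c _ => sum_congr rfl fun c' _ => by ring

/-- Clone symmetry in `b ↔ b'`. [folklore] -/
theorem E6_swap_b (Φ : α → α → β → β → γ → γ → ℝ) :
    E6 wA wB wC (fun a a' b b' c c' => Φ a a' b' b c c') = E6 wA wB wC Φ := by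
  unfold E6
  refine sum_congr rfl fun a _ => sum_congr rfl fun a' _ => congrArg _ ?_
  rw [sum_comm]
  exact sum_congr rfl fun b _ => sum_congr rfl fun b' _ => by ring

/-- Clone symmetry in `a ↔ a'`. [folklore] -/
theorem E6_swap_a (Φ : α → α → β → β → γ → γ → ℝ) :
    E6 wA wB wC (fun a a' b b' c c' => Φ a' a b b' c c') = E6 wA wB wC Φ := by
  unfold E6
  rw [sum_comm]
  exact sum_congr rfl fun a _ => sum_congr rfl fun a' _ => by ring

/-- Collapsing the unused clones: an integrand depending on `(a,b,c)` only integrates to the plain product expectation. [folklore] -/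
theorem E6_of_abc (hA : ∑ a, wA a = 1) (hB : ∑ b, wB b = 1) (hC : ∑ c, wC c = 1) (ψ : α → β → γ → ℝ) :
    E6 wA wB wC (fun a _ b _ c _ => ψ a b c) = ∑ a, ∑ b, ∑ c, wA a * wB b * wC c * ψ a b c := by
  unfold E6
  have hc : ∀ a b, (∑ c, ∑ c', wC c * wC c' * ψ a b c) = ∑ c, wC c * ψ a b c := by
    intro a b
    refine sum_congr rfl fun c _ => ?_
    rw [show (∑ c', wC c * wC c' * ψ a b c) = (∑ c', wC c') * (wC c * ψ a b c) by
      rw [sum_mul]; exact sum_congr rfl fun _ _ => by ring, hC, one_mul]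
  have hb : ∀ a, (∑ b, ∑ b', wB b * wB b' * ∑ c, wC c * ψ a b c) = ∑ b, wB b * ∑ c, wC c * ψ a b c := by
    intro a
    refine sum_congr rfl fun b _ => ?_
    rw [show (∑ b', wB b * wB b' * ∑ c, wC c * ψ a b c) = (∑ b', wB b') * (wB b * ∑ c, wC c * ψ a b c) by
      rw [sum_mul]; exact sum_congr rfl fun _ _ => by ring, hB, one_mul]
  simp_rw [hc, hb]
  refine sum_congr rfl fun a _ => ?_
  rw [show (∑ a', wA a * wA a' * ∑ b, wB b * ∑ c, wC c * ψ a b c) = (∑ a', wA a') * (wA a * ∑ b, wB b * ∑ c, wC c * ψ a b c) by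
    rw [sum_mul]; exact sum_congr rfl fun _ _ => by ring, hA, one_mul]
  rw [mul_sum]; refine sum_congr rfl fun b _ => ?_
  rw [mul_sum, mul_sum]; exact sum_congr rfl fun c _ => by ring

/-- Nested versus flat triple sums (plumbing). [folklore] -/
theorem nest3 (Ψ : α → β → γ → ℝ) :
    (∑ a, wA a * ∑ b, wB b * ∑ c, wC c * Ψ a b c) = ∑ a, ∑ b, ∑ c, wA a * wB b * wC c * Ψ a b c := by
  refine sum_congr rfl fun a _ => ?_
  rw [mul_sum]; refine sum_congr rfl fun b _ => ?_
  rw [mul_sum, mul_sum]; exact sum_congr rfl fun c _ => by ring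

/-- Product rule: an `(a,b,c)`-factor times an `(a',b',c')`-factor. [folklore] -/
theorem E6_prod (Φ Ψ : α → β → γ → ℝ) :
    E6 wA wB wC (fun a a' b b' c c' => Φ a b c * Ψ a' b' c') =
      (∑ a, ∑ b, ∑ c, wA a * wB b * wC c * Φ a b c) * ∑ a, ∑ b, ∑ c, wA a * wB b * wC c * Ψ a b c := by
  unfold E6
  have hc : ∀ a a' b b', (∑ c, ∑ c', wC c * wC c' * (Φ a b c * Ψ a' b' c')) =
      (∑ c, wC c * Φ a b c) * ∑ c', wC c' * Ψ a' b' c' := by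
    intro a a' b b'
    rw [sum_mul_sum]; exact sum_congr rfl fun c _ => sum_congr rfl fun c' _ => by ring
  simp_rw [hc]
  have hb : ∀ a a', (∑ b, ∑ b', wB b * wB b' * ((∑ c, wC c * Φ a b c) * ∑ c', wC c' * Ψ a' b' c')) =
      (∑ b, wB b * ∑ c, wC c * Φ a b c) * ∑ b', wB b' * ∑ c', wC c' * Ψ a' b' c' := by
    intro a a'
    rw [sum_mul_sum]; exact sum_congr rfl fun b _ => sum_congr rfl fun b' _ => by ring
  simp_rw [hb]
  have ha : (∑ a, ∑ a', wA a * wA a' * ((∑ b, wB b * ∑ c, wC c * Φ a b c) * ∑ b', wB b' * ∑ c', wC c' * Ψ a' b' c')) =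
      (∑ a, wA a * ∑ b, wB b * ∑ c, wC c * Φ a b c) * ∑ a', wA a' * ∑ b', wB b' * ∑ c', wC c' * Ψ a' b' c' := by
    rw [sum_mul_sum]; exact sum_congr rfl fun a _ => sum_congr rfl fun a' _ => by ring
  rw [ha, nest3, nest3]

/-- Three-way product rule for factors living on `(a,c)`, `(b,c')`, `(a',b')`. [folklore] -/
theorem E6_prod3 (φ : α → γ → ℝ) (χ : β → γ → ℝ) (ψ : α → β → ℝ) :
    E6 wA wB wC (fun a a' b b' c c' => φ a c * χ b c' * ψ a' b') =
      (∑ a, ∑ c, wA a * wC c * φ a c) * (∑ b, ∑ c, wB b * wC c * χ b c) * ∑ a, ∑ b, wA a * wB b * ψ a b := by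
  unfold E6
  have hc : ∀ a a' b b', (∑ c, ∑ c', wC c * wC c' * (φ a c * χ b c' * ψ a' b')) =
      ψ a' b' * ((∑ c, wC c * φ a c) * ∑ c', wC c' * χ b c') := by
    intro a a' b b'
    conv_rhs => rw [sum_mul_sum, mul_sum]
    refine sum_congr rfl fun c _ => ?_
    conv_rhs => rw [mul_sum]
    exact sum_congr rfl fun c' _ => by ring
  simp_rw [hc]
  have hb : ∀ a a', (∑ b, ∑ b', wB b * wB b' * (ψ a' b' * ((∑ c, wC c * φ a c) * ∑ c', wC c' * χ b c'))) =
      (∑ c, wC c * φ a c) * ((∑ b, wB b * ∑ c', wC c' * χ b c') * ∑ b', wB b' * ψ a' b') := by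
    intro a a'
    conv_rhs => rw [sum_mul_sum, mul_sum]
    refine sum_congr rfl fun b _ => ?_
    conv_rhs => rw [mul_sum]
    exact sum_congr rfl fun b' _ => by ring
  simp_rw [hb]
  have ha : (∑ a, ∑ a', wA a * wA a' * ((∑ c, wC c * φ a c) * ((∑ b, wB b * ∑ c', wC c' * χ b c') * ∑ b', wB b' * ψ a' b'))) =
      (∑ b, wB b * ∑ c', wC c' * χ b c') * ((∑ a, wA a * ∑ c, wC c * φ a c) * ∑ a', wA a' * ∑ b', wB b' * ψ a' b') := by
    conv_rhs => rw [sum_mul_sum, mul_sum]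
    refine sum_congr rfl fun a _ => ?_
    conv_rhs => rw [mul_sum]
    exact sum_congr rfl fun a' _ => by ring
  rw [ha]
  have e1 : (∑ a, wA a * ∑ c, wC c * φ a c) = ∑ a, ∑ c, wA a * wC c * φ a c :=
    sum_congr rfl fun a _ => by rw [mul_sum]; exact sum_congr rfl fun c _ => by ring
  have e2 : (∑ b, wB b * ∑ c', wC c' * χ b c') = ∑ b, ∑ c, wB b * wC c * χ b c :=
    sum_congr rfl fun b _ => by rw [mul_sum]; exact sum_congr rfl fun c _ => by ring
  have e3 : (∑ a', wA a' * ∑ b', wB b' * ψ a' b') = ∑ a, ∑ b, wA a * wB b * ψ a b :=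
    sum_congr rfl fun a _ => by rw [mul_sum]; exact sum_congr rfl fun b _ => by ring
  rw [e1, e2, e3]; ring

/-- `E6` in the nesting `(c, b, a)` (plumbing for the `S_A` pattern). [folklore] -/
theorem E6_cba (Φ : α → α → β → β → γ → γ → ℝ) :
    E6 wA wB wC Φ = ∑ c, ∑ c', wC c * wC c' * ∑ b, ∑ b', wB b * wB b' * ∑ a, ∑ a', wA a * wA a' * Φ a a' b b' c c' := by
  unfold E6
  rw [swap_pairs wA wB (fun a a' b b' => ∑ c, ∑ c', wC c * wC c' * Φ a a' b b' c c')]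
  have inner : ∀ b b', (∑ a, ∑ a', wA a * wA a' * ∑ c, ∑ c', wC c * wC c' * Φ a a' b b' c c') =
      ∑ c, ∑ c', wC c * wC c' * ∑ a, ∑ a', wA a * wA a' * Φ a a' b b' c c' := fun b b' =>
    swap_pairs wA wC (fun a a' c c' => Φ a a' b b' c c')
  simp_rw [inner]
  exact swap_pairs wB wC (fun b b' c c' => ∑ a, ∑ a', wA a * wA a' * Φ a a' b b' c c')

/-- `E6` in the nesting `(c, a, b)` (plumbing for the `S_B` pattern). [folklore] -/
theorem E6_cab (Φ : α → α → β → β → γ → γ → ℝ) :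
    E6 wA wB wC Φ = ∑ c, ∑ c', wC c * wC c' * ∑ a, ∑ a', wA a * wA a' * ∑ b, ∑ b', wB b * wB b' * Φ a a' b b' c c' := by
  unfold E6
  have inner : ∀ a a', (∑ b, ∑ b', wB b * wB b' * ∑ c, ∑ c', wC c * wC c' * Φ a a' b b' c c') =
      ∑ c, ∑ c', wC c * wC c' * ∑ b, ∑ b', wB b * wB b' * Φ a a' b b' c c' := fun a a' =>
    swap_pairs wB wC (fun b b' c c' => Φ a a' b b' c c')
  simp_rw [inner]
  exact swap_pairs wA wC (fun a a' c c' => ∑ b, ∑ b', wB b * wB b' * Φ a a' b b' c c')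

end E6

end SahiChainTriangle

end Summit.CriticalPhenomena.PercolationContinuityZ3.Theorems
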